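import Mathlib.MeasureTheory.Integral.IntervalIntegral.Periodic
import Mathlib.MeasureTheory.Measure.Haar.InnerProductSpace
import Mathlib.MeasureTheory.Measure.Prod
import Literature.Analysis.FunctionSpaces.FlatTorus
import Literature.Analysis.FunctionSpaces.TorusCalculus
import HarnessLib

/-!
# Discharged facts: the fundamental domain of the flat torus, and product measurability

`Literature.Analysis.FunctionSpaces.FlatTorus` records as named facts that the covering map
`proj : ℝ^d → T^d` restricted to the unit cube `[0,1)^d` is measure preserving
(`Torus.measurePreserving_proj_unitCube`) and that torus integrals are cube integrals of the lift
(`Torus.integral_eq_integral_lift`) (Grafakos, §3.1.1). Both are proved here through the section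
`Torus.repr : T^d → [0,1)^d`:

* `Torus.measurePreserving_equivIco_coe` — `UnitAddCircle → [0,1) ⊂ ℝ` is measure preserving
  (from Mathlib's `UnitAddCircle.measurePreserving_mk`);
* `Torus.measurePreserving_repr` — `repr` pushes `volume` on `T^d` to Lebesgue measure on the
  unit cube (`measurePreserving_pi` coordinatewise, then `PiLp.volume_preserving_toLp`);
* `Torus.measurePreserving_proj_unitCube_holds`, `Torus.integral_eq_integral_lift_holds`;
* `Torus.quasiMeasurePreserving_repr` and the **product-measurability transfer**
  `Torus.aestronglyMeasurable_uncurry_of_stLift`: if the space–time lift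
  `stLift u : ℝ × ℝ^d → F` is a.e.-strongly measurable for `μ ⊗ volume`, then so is
  `uncurry u : ℝ × T^d → F` for `μ ⊗ volume` (`uncurry u = stLift u ∘ (id × repr)`), with the
  restricted-Lebesgue form `Torus.aestronglyMeasurable_uncurry_of_stLift_restrict` used by the
  fluid files (whose solution classes record measurability of `stLift u` on `(0,T) × ℝ^d`, while
  Fourier coefficients in `x` are integrals over `T^d`);
* `Torus.repr_proj_of_mem_unitCube_holds` — discharge of the named fact
  `Torus.repr_proj_of_mem_unitCube`: `[0,1)^d` is a set of representatives, `repr (proj y) = y`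
  for `y ∈ [0,1)^d`.
* the descent facts of `FlatTorus` — `Torus.exists_repr_proj_eq_add_latticeVec_holds`,
  `Torus.IsLatticePeriodic.eq_of_proj_eq_holds`, `Torus.lift_descend_holds`,
  `Torus.descend_lift_holds`, `Torus.exists_lift_eq_of_isLatticePeriodic_holds`: lattice-periodic
  functions on `ℝ^d` are exactly the lifts of functions on `T^d` (all from the proved
  `Torus.proj_eq_proj_iff_holds` and `Torus.IsLatticePeriodic.add_latticeVec_holds`).

## References

* L. Grafakos, *Classical Fourier Analysis*, 3rd ed. (2014), §3.1.1 (`T^n = ℝ^n/ℤ^n`, the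
  fundamental domain `[0,1)^n`, integration of `1`-periodic functions).
-/

open MeasureTheory Measure Set Filter Topology Function

noncomputable section

namespace Literature.Analysis.FunctionSpaces

namespace Torus

variable {d : Type*} [Fintype d]

/-! ## The section `repr` is measure preserving onto the unit cube -/

/-- The fundamental-domain coordinate `UnitAddCircle → [0, 1) ⊂ ℝ` (Mathlib's
`AddCircle.equivIco 1 0`) pushes Haar–Lebesgue measure on the circle to Lebesgue measure on
`[0, 1)`: it is a one-sided inverse of the covering map, which is measure preserving from
`volume ⌊ [0,1)` (Mathlib `UnitAddCircle.measurePreserving_mk`, stated with `(0,1]`, an a.e.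
equal fundamental interval) (Grafakos, §3.1.1). [folklore] -/
theorem measurePreserving_equivIco_coe :
    MeasurePreserving (fun y : UnitAddCircle => ((AddCircle.equivIco (1 : ℝ) (0 : ℝ) y : ℝ)))
      volume ((volume : Measure ℝ).restrict (Ico 0 1)) := by
  have hg : Measurable fun y : UnitAddCircle => ((AddCircle.equivIco (1 : ℝ) (0 : ℝ) y : ℝ)) :=
    measurable_subtype_coe.comp (AddCircle.measurableEquivIco (1 : ℝ) 0).measurable
  refine ⟨hg, ?_⟩
  have hmk := UnitAddCircle.measurePreserving_mk 0
  rw [zero_add, ← restrict_Ico_eq_restrict_Ioc] at hmk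
  rw [← hmk.map_eq, Measure.map_map hg AddCircle.measurable_mk']
  have hcongr : ((fun y : UnitAddCircle => ((AddCircle.equivIco (1 : ℝ) (0 : ℝ) y : ℝ))) ∘
      ((↑) : ℝ → UnitAddCircle)) =ᵐ[(volume : Measure ℝ).restrict (Ico 0 1)] id := by
    filter_upwards [ae_restrict_mem measurableSet_Ico] with x hx
    have hx' : x ∈ Ico (0 : ℝ) (0 + 1) := by simpa using hx
    simp only [Function.comp_apply, id_eq, AddCircle.equivIco_coe_eq hx']
  rw [Measure.map_congr hcongr, Measure.map_id]

/-- **The section `repr : T^d → [0,1)^d ⊂ ℝ^d` is measure preserving** from `volume` on the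
torus to Lebesgue measure restricted to the unit cube: coordinatewise
`measurePreserving_equivIco_coe` (`MeasureTheory.measurePreserving_pi`,
`Measure.restrict_pi_pi`), followed by the volume-preserving identification
`(d → ℝ) ≃ EuclideanSpace ℝ d` (`PiLp.volume_preserving_toLp`) (Grafakos, §3.1.1). [cite: Grafakos2014, §3.1.1] -/
theorem measurePreserving_repr :
    MeasurePreserving (repr : UnitAddTorus d → EuclideanSpace ℝ d) volume
      (volume.restrict (unitCube d)) := by
  have h1 : MeasurePreserving
      (fun (x : UnitAddTorus d) (i : d) => ((AddCircle.equivIco (1 : ℝ) (0 : ℝ) (x i) : ℝ)))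
      volume (Measure.pi fun _ : d => (volume : Measure ℝ).restrict (Ico 0 1)) := by
    have h := measurePreserving_pi (fun _ : d => (volume : Measure UnitAddCircle))
      (fun _ : d => (volume : Measure ℝ).restrict (Ico 0 1))
      (fun _ => measurePreserving_equivIco_coe)
    rwa [← volume_pi] at h
  have h2 : (Measure.pi fun _ : d => (volume : Measure ℝ).restrict (Ico 0 1)) =
      (volume : Measure (d → ℝ)).restrict (Set.pi univ fun _ => Ico 0 1) := by
    rw [volume_pi, ← Measure.restrict_pi_pi]
  have h3 : MeasurePreserving (WithLp.toLp 2 : (d → ℝ) → EuclideanSpace ℝ d)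
      ((volume : Measure (d → ℝ)).restrict (Set.pi univ fun _ => Ico 0 1))
      (volume.restrict (unitCube d)) := by
    have h := (PiLp.volume_preserving_toLp d).restrict_preimage (measurableSet_unitCube (d := d))
    have hpre : (WithLp.toLp 2 : (d → ℝ) → EuclideanSpace ℝ d) ⁻¹' unitCube d =
        Set.pi univ fun _ => Ico 0 1 := by
      ext y
      simp [unitCube]
    rwa [hpre] at h
  rw [h2] at h1
  exact h3.comp h1

/-- `repr` is quasi measure preserving into `ℝ^d` with Lebesgue measure (its image measure is
Lebesgue measure on the unit cube, `measurePreserving_repr`). [folklore] -/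
theorem quasiMeasurePreserving_repr :
    QuasiMeasurePreserving (repr : UnitAddTorus d → EuclideanSpace ℝ d) volume volume :=
  ⟨measurable_repr, by
    rw [(measurePreserving_repr (d := d)).map_eq]
    exact Measure.restrict_le_self.absolutelyContinuous⟩

/-- Discharge of the named fact `Torus.measurePreserving_proj_unitCube`: `proj` restricted to
the unit cube is measure preserving onto the torus — `volume ⌊ [0,1)^d = repr_* volume`
(`measurePreserving_repr`) and `proj ∘ repr = id` (Grafakos, §3.1.1). [cite: Grafakos2014, §3.1.1] -/
theorem measurePreserving_proj_unitCube_holds : measurePreserving_proj_unitCube (d := d) := by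
  classical
  refine ⟨measurable_proj, ?_⟩
  rw [← (measurePreserving_repr (d := d)).map_eq, Measure.map_map measurable_proj measurable_repr]
  have : (proj ∘ repr : UnitAddTorus d → UnitAddTorus d) = id := funext proj_repr
  rw [this, Measure.map_id]

/-- Discharge of the named fact `Torus.integral_eq_integral_lift`:
`∫_{T^d} f = ∫_{[0,1)^d} f ∘ proj` for every `f` (Grafakos, §3.1.1). For a.e.-strongly
measurable `f` this is the change of variables along the measure-preserving `proj`
(`MeasureTheory.integral_map`); otherwise both sides are the junk value `0`, because
`f = (f ∘ proj) ∘ repr` would inherit measurability from `f ∘ proj` along the measure-preserving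
section `repr`. [cite: Grafakos2014, §3.1.1] -/
theorem integral_eq_integral_lift_holds {F : Type*} [NormedAddCommGroup F] [NormedSpace ℝ F] :
    integral_eq_integral_lift (d := d) (F := F) := by
  classical
  intro f
  have hmp := measurePreserving_proj_unitCube_holds (d := d)
  by_cases hf : AEStronglyMeasurable f (volume : Measure (UnitAddTorus d))
  · rw [← hmp.map_eq] at hf ⊢
    exact integral_map measurable_proj.aemeasurable hf
  · rw [integral_non_aestronglyMeasurable hf, integral_non_aestronglyMeasurable]
    intro hfp
    apply hf
    have h : f = (lift f) ∘ repr := by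
      funext x
      simp
    rw [h]
    exact hfp.comp_quasiMeasurePreserving measurePreserving_repr.quasiMeasurePreserving

/-! ## Product measurability: from the space–time lift to `ℝ × T^d` -/

/-- **Measurability transfer from the space–time lift.** If `stLift u : ℝ × ℝ^d → F`,
`(t, y) ↦ u t (proj y)`, is a.e.-strongly measurable for `μ ⊗ volume`, then
`uncurry u : ℝ × T^d → F` is a.e.-strongly measurable for `μ ⊗ volume`: indeed
`uncurry u = stLift u ∘ (id × repr)` and `id × repr` is quasi measure preserving
(`quasiMeasurePreserving_repr`, `MeasureTheory.QuasiMeasurePreserving.prodMap`) (Grafakos, §3.1.1). [folklore] -/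
theorem aestronglyMeasurable_uncurry_of_stLift {F : Type*} [TopologicalSpace F]
    {μ : Measure ℝ} [SFinite μ] {u : ℝ → UnitAddTorus d → F}
    (hu : AEStronglyMeasurable (stLift u) (μ.prod volume)) :
    AEStronglyMeasurable (uncurry u) (μ.prod volume) := by
  have h : uncurry u = stLift u ∘ Prod.map id repr := by
    funext ⟨t, x⟩
    simp [stLift]
  rw [h]
  exact hu.comp_quasiMeasurePreserving
    (MeasureTheory.QuasiMeasurePreserving.prodMap (QuasiMeasurePreserving.id μ)
      quasiMeasurePreserving_repr)

/-- Restricted-Lebesgue form of `aestronglyMeasurable_uncurry_of_stLift`: measurability of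
`stLift u` on `S × ℝ^d` gives measurability of `uncurry u` on `S × T^d` (the form in which the
fluid solution classes, e.g. `Torus.IsWeakNSSolutionForcedOn`, record measurability, versus the
form consumed by Fourier coefficients in `x`). [folklore] -/
theorem aestronglyMeasurable_uncurry_of_stLift_restrict {F : Type*} [TopologicalSpace F]
    {S : Set ℝ} {u : ℝ → UnitAddTorus d → F}
    (hu : AEStronglyMeasurable (stLift u) (volume.restrict (S ×ˢ univ))) :
    AEStronglyMeasurable (uncurry u) (volume.restrict (S ×ˢ univ)) := by
  rw [Measure.volume_eq_prod, ← Measure.prod_restrict, Measure.restrict_univ] at hu ⊢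
  exact aestronglyMeasurable_uncurry_of_stLift hu

/-! ## The unit cube is a set of representatives -/

omit [Fintype d] in
/-- Discharge of the named fact `Torus.repr_proj_of_mem_unitCube`: the half-open cube `[0,1)^d`
is a set of representatives for `T^d = ℝ^d/ℤ^d`, i.e. `repr (proj y) = y` for `y ∈ [0,1)^d`
(Grafakos, *Classical Fourier Analysis*, 3rd ed., §3.1.1, p. 174: "The `n`-torus `Tⁿ` is the
cube `[0,1]ⁿ` with opposite sides identified … `x ≡ y` if `x - y ∈ ℤⁿ` … `Tⁿ` is then defined as
the set `ℝⁿ/ℤⁿ` of all such equivalence classes"; each class meets `[0,1)ⁿ` in exactly one point,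
here `repr`). Proof: coordinatewise, `AddCircle.equivIco 1 0` inverts the quotient map `ℝ → ℝ/ℤ`
on `[0, 0 + 1)` (Mathlib `AddCircle.equivIco_coe_eq`). [cite: Grafakos2014, §3.1.1] -/
theorem repr_proj_of_mem_unitCube_holds : repr_proj_of_mem_unitCube (d := d) := by
  intro y hy
  ext i
  have hi : y i ∈ Ico (0 : ℝ) (0 + 1) := by simpa only [zero_add] using hy i
  rw [repr_apply, proj_apply, AddCircle.equivIco_coe_eq hi]

/-! ## Descent along the covering map: discharges of the `FlatTorus` descent facts -/

section Descent

variable [DecidableEq d] {F : Type*}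

/-- Discharge of the named fact `Torus.exists_repr_proj_eq_add_latticeVec` (`FlatTorus`): the
fundamental-domain representative of `proj y` differs from `y` by a lattice vector, since both
project to the same point of `T^d = ℝ^d/ℤ^d` (`proj_eq_proj_iff_holds`; Grafakos, *Classical
Fourier Analysis*, 3rd ed., §3.1.1, `x ≡ y ⟺ x - y ∈ ℤⁿ`). [cite: Grafakos2014, §3.1.1] -/
theorem exists_repr_proj_eq_add_latticeVec_holds :
    exists_repr_proj_eq_add_latticeVec (d := d) := fun y =>
  (proj_eq_proj_iff_holds y (repr (proj y))).1 (proj_repr (proj y)).symm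

/-- Discharge of the named fact `Torus.IsLatticePeriodic.eq_of_proj_eq` (`FlatTorus`): a
lattice-periodic function on `ℝ^d` is constant on the fibres of the covering map `ℝ^d → T^d`
(two points with the same projection differ by a lattice vector, `proj_eq_proj_iff_holds`, and
periodic functions are invariant under lattice translations,
`IsLatticePeriodic.add_latticeVec_holds`; Grafakos, §3.1.1). [cite: Grafakos2014, §3.1.1] -/
theorem IsLatticePeriodic.eq_of_proj_eq_holds :
    IsLatticePeriodic.eq_of_proj_eq (d := d) (F := F) := by
  intro g hg x y h
  obtain ⟨k, rfl⟩ := (proj_eq_proj_iff_holds x y).1 h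
  exact (IsLatticePeriodic.add_latticeVec_holds hg x k).symm

/-- Discharge of the named fact `Torus.lift_descend` (`FlatTorus`): the descent of a
lattice-periodic `g` lifts back to `g`, `lift (descend g hg) = g`, because
`lift (descend g hg) y = g (repr (proj y))` and `repr (proj y) ≡ y` modulo `ℤ^d`
(Grafakos, §3.1.1: `1`-periodic functions on `ℝⁿ` are the functions on `Tⁿ`). [cite: Grafakos2014, §3.1.1] -/
theorem lift_descend_holds : lift_descend (d := d) (F := F) := by
  intro g hg
  funext y
  exact IsLatticePeriodic.eq_of_proj_eq_holds hg (proj_repr (proj y))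

/-- Discharge of the named fact `Torus.descend_lift` (`FlatTorus`): `descend (lift f) = f`
(`lift` is injective and `lift (descend (lift f)) = lift f` by `lift_descend_holds`;
Grafakos, §3.1.1). [cite: Grafakos2014, §3.1.1] -/
theorem descend_lift_holds : descend_lift (d := d) (F := F) := fun _ =>
  lift_injective (lift_descend_holds _ _)

/-- Discharge of the named fact `Torus.exists_lift_eq_of_isLatticePeriodic` (`FlatTorus`): a
lattice-periodic function on `ℝ^d` is the lift of a unique function on `T^d`, namely its
descent (existence: `lift_descend_holds`; uniqueness: injectivity of `lift`)
(Grafakos, §3.1.1). [cite: Grafakos2014, §3.1.1] -/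
theorem exists_lift_eq_of_isLatticePeriodic_holds :
    exists_lift_eq_of_isLatticePeriodic (d := d) (F := F) := fun {g} hg =>
  ⟨descend g hg, lift_descend_holds g hg,
    fun _ hf => lift_injective (hf.trans (lift_descend_holds g hg).symm)⟩

end Descent

end Torus

end Literature.Analysis.FunctionSpaces
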